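import Summits.CriticalPhenomena.PercolationContinuityZ3.Theorems.PercNearOneGluingNoHeavyLowerTailSahiThreeChainsCert

/-!
# `NoHeavyLowerTail` (crux stmt-CriticalPhenomena-4575), Sahi programme (prim-master-conj gen 40): BRIDGE A for the three-chains
# kernel — bitmask up-sets of `[3]³`, completeness of the nested-slice enumeration `ups3`, and the lower bound of the DP `minUp3`

Support file (`--supports stmt-CriticalPhenomena-4575`).  Pure plumbing over the definitions of `…SahiThreeChainsCert` (no analysis):

* `IsUp3 T` — `T < 2^27` is the bitmask of an up-set of `[3]³` (cell `(i,j,k) ↦ i + 3j + 9k`); `slice T k = (T >>> 9k) % 512`;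
* `isUp2_slice`, `slice_land_slice_succ` — the slices of an up-set are up-sets of `[3]²` and increase with `k`; `eq_of_slices` — `T` is
  recovered from its three slices;
* `mem_ups2`, `mem_ups3`, `exists_ups3_eq` — COMPLETENESS: every `IsUp3` bitmask is `ups3.getD b 0` for some `b < 980`;
* `minUp3_le` — for every `IsUp3 A`, `minUp3 f ≤ Σ_{u < 27, u ∈ A} f[u]` (instantiate the DP at the slice indices of `A`);
* `sum_phi_nonneg_of_check` — consequently, if all `980²` DP minima of the `φ`-tables are `≥ 0` (the blocks `checkBlock_A…D`), then
  `Σ_{u ∈ A} φ_{B,C}(u) ≥ 0` for ALL up-set bitmasks `A, B, C` of `[3]³` — the combinatorial kernel `κ₃ ≥ 0` in its `φ`-form.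
The identification with the Latin-triple sum `κ₃`, the orbit-averaging identity for `E₃` and the final `SahiPositive` theorem are BRIDGE B.
-/

namespace Summit.CriticalPhenomena.PercolationContinuityZ3.Theorems.SahiThreeChains

open Finset

/-! ## Bitmask up-sets of `[3]³` and their slices -/

/-- `T` is the bitmask of an UP-set of `[3]³`: `T < 2^27` and membership is inherited upward along each of the three axes
(cell `u = i + 3j + 9k`; the successors of `u` are `u+1` if `i < 2`, `u+3` if `j < 2`, `u+9` if `k < 2`). [this work] -/
def IsUp3 (T : ℕ) : Prop :=
  T < 2 ^ 27 ∧ ∀ u, u < 27 → T.testBit u = true →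
    (u % 3 ≠ 2 → T.testBit (u + 1) = true) ∧ (u / 3 % 3 ≠ 2 → T.testBit (u + 3) = true) ∧ (u / 9 ≠ 2 → T.testBit (u + 9) = true)

/-- Slice `k` of a bitmask of `[3]³`: the bitmask of `[3]²` in bits `9k … 9k+8`. [this work] -/
def slice (T k : ℕ) : ℕ := (T >>> (9 * k)) % 2 ^ 9

/-- Bits of a slice. [this work] -/
theorem testBit_slice (T k v : ℕ) : (slice T k).testBit v = (decide (v < 9) && T.testBit (9 * k + v)) := by
  unfold slice
  rw [Nat.testBit_mod_two_pow, Nat.testBit_shiftRight]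

/-- Bits of a slice below `9`. [this work] -/
theorem testBit_slice_of_lt {T k v : ℕ} (hv : v < 9) : (slice T k).testBit v = T.testBit (9 * k + v) := by
  rw [testBit_slice, decide_eq_true hv, Bool.true_and]

/-- A slice is `< 512`. [this work] -/
theorem slice_lt (T k : ℕ) : slice T k < 512 := Nat.mod_lt _ (by norm_num)

/-- Unfolding the Boolean test `isUp2` into a statement about bits. [this work] -/
theorem isUp2_eq_true_iff (S : ℕ) : isUp2 S = true ↔ ∀ v, v < 9 → S.testBit v = true →
    (v % 3 ≠ 2 → S.testBit (v + 1) = true) ∧ (v / 3 ≠ 2 → S.testBit (v + 3) = true) := by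
  unfold isUp2
  simp only [List.all_eq_true, List.mem_range, Bool.or_eq_true, Bool.not_eq_true', Bool.and_eq_true, beq_iff_eq]
  constructor
  · intro h v hv hS
    rcases h v hv with h0 | ⟨h1, h2⟩
    · rw [hS] at h0; exact absurd h0 (by decide)
    · refine ⟨fun hne => ?_, fun hne => ?_⟩
      · rcases h1 with h1 | h1
        · exact absurd h1 hne
        · exact h1
      · rcases h2 with h2 | h2
        · exact absurd h2 hne
        · exact h2
  · intro h v hv
    by_cases hS : S.testBit v = true
    · right
      obtain ⟨h1, h2⟩ := h v hv hS
      refine ⟨?_, ?_⟩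
      · by_cases hne : v % 3 = 2
        · exact Or.inl hne
        · exact Or.inr (h1 hne)
      · by_cases hne : v / 3 = 2
        · exact Or.inl hne
        · exact Or.inr (h2 hne)
    · left
      simpa using hS

/-- The slices of an up-set of `[3]³` are up-sets of `[3]²`. [this work] -/
theorem isUp2_slice {T : ℕ} (hT : IsUp3 T) {k : ℕ} (hk : k < 3) : isUp2 (slice T k) = true := by
  rw [isUp2_eq_true_iff]
  intro v hv hS
  rw [testBit_slice_of_lt hv] at hS
  have hu : 9 * k + v < 27 := by omega
  obtain ⟨h1, h2, -⟩ := hT.2 _ hu hS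
  refine ⟨fun hne => ?_, fun hne => ?_⟩
  · rw [testBit_slice_of_lt (by omega : v + 1 < 9)]
    have : (9 * k + v) % 3 ≠ 2 := by omega
    have h := h1 this
    rwa [show 9 * k + v + 1 = 9 * k + (v + 1) by ring] at h
  · rw [testBit_slice_of_lt (by omega : v + 3 < 9)]
    have : (9 * k + v) / 3 % 3 ≠ 2 := by omega
    have h := h2 this
    rwa [show 9 * k + v + 3 = 9 * k + (v + 3) by ring] at h

/-- The slices of an up-set increase: `slice T k ⊆ slice T (k+1)` as bitmasks. [this work] -/
theorem slice_land_slice_succ {T : ℕ} (hT : IsUp3 T) {k : ℕ} (hk : k < 2) :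
    slice T k &&& slice T (k + 1) = slice T k := by
  apply Nat.eq_of_testBit_eq
  intro v
  rw [Nat.testBit_land, testBit_slice, testBit_slice]
  by_cases hv : v < 9
  · rw [decide_eq_true hv, Bool.true_and, Bool.true_and]
    by_cases hS : T.testBit (9 * k + v) = true
    · have hu : 9 * k + v < 27 := by omega
      obtain ⟨-, -, h3⟩ := hT.2 _ hu hS
      have : (9 * k + v) / 9 ≠ 2 := by omega
      have h := h3 this
      rw [show 9 * k + v + 9 = 9 * (k + 1) + v by ring] at h
      rw [hS, h]; rfl
    · have hS' : T.testBit (9 * k + v) = false := by simpa using hS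
      rw [hS']; rfl
  · rw [decide_eq_false hv]; rfl

/-- A bitmask `T < 2^27` is recovered from its three slices. [this work] -/
theorem eq_of_slices {T : ℕ} (hT : T < 2 ^ 27) : slice T 0 ||| (slice T 1 <<< 9) ||| (slice T 2 <<< 18) = T := by
  apply Nat.eq_of_testBit_eq
  intro u
  rw [Nat.testBit_lor, Nat.testBit_lor, Nat.testBit_shiftLeft, Nat.testBit_shiftLeft, testBit_slice, testBit_slice, testBit_slice]
  by_cases h27 : u < 27
  · by_cases h9 : u < 9
    · rw [decide_eq_true h9, decide_eq_false (by omega : ¬ u ≥ 9), decide_eq_false (by omega : ¬ u ≥ 18)]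
      simp
    · by_cases h18 : u < 18
      · rw [decide_eq_false h9, decide_eq_true (by omega : u ≥ 9), decide_eq_true (by omega : u - 9 < 9),
          decide_eq_false (by omega : ¬ u ≥ 18)]
        simp [show 9 * 1 + (u - 9) = u by omega]
      · rw [decide_eq_false h9, decide_eq_true (by omega : u ≥ 9), decide_eq_false (by omega : ¬ (u - 9 < 9)),
          decide_eq_true (by omega : u ≥ 18), decide_eq_true (by omega : u - 18 < 9)]
        simp [show 9 * 2 + (u - 18) = u by omega]
  · have hTu : T.testBit u = false := Nat.testBit_lt_two_pow (lt_of_lt_of_le hT (Nat.pow_le_pow_right (by norm_num) (by omega)))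
    rw [hTu, decide_eq_false (by omega : ¬ u < 9), decide_eq_false (by omega : ¬ (u - 9 < 9)),
      decide_eq_false (by omega : ¬ (u - 18 < 9))]
    simp

/-! ## Completeness of the enumerations `ups2`, `ups3` -/

/-- `Array.getD` below the size is the entry. [this work] -/
theorem getD_eq_getElem {α : Type*} (A : Array α) (d : α) {a : ℕ} (h : a < A.size) : A.getD a d = A[a] := by
  simp [Array.getD, h]

/-- Entries of a mapped `range` array. [this work] -/
theorem getD_map_range {α : Type*} (g : ℕ → α) (d : α) {n a : ℕ} (h : a < n) :
    (((List.range n).map g).toArray).getD a d = g a := by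
  rw [getD_eq_getElem _ _ (by simpa using h)]
  simp

/-- `ups3` has `980` entries (compiled evaluation). [this work] -/
theorem ups3_size : ups3.size = 980 := by native_decide

/-- `ups2` has `20` entries (compiled evaluation). [this work] -/
theorem ups2_size : ups2.size = 20 := by native_decide

/-- Every up-set bitmask of `[3]²` is an entry of `ups2`. [this work] -/
theorem exists_ups2_eq {S : ℕ} (hS : S < 512) (hup : isUp2 S = true) : ∃ a, a < 20 ∧ ups2.getD a 0 = S := by
  have hmem : S ∈ ups2.toList := by
    simp only [ups2, List.toList_toArray, List.mem_filter, List.mem_range]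
    exact ⟨hS, hup⟩
  obtain ⟨i, hi, hget⟩ := List.getElem_of_mem hmem
  refine ⟨i, ?_, ?_⟩
  · rw [Array.length_toList, ups2_size] at hi; exact hi
  · rw [Array.length_toList] at hi
    rw [getD_eq_getElem _ _ hi, ← hget, Array.getElem_toList]

/-- The entries of `subIdx`. [this work] -/
theorem mem_subIdx_getD {a2 a1 : ℕ} (h2 : a2 < 20) (h1 : a1 < 20)
    (hsub : ups2.getD a1 0 &&& ups2.getD a2 0 = ups2.getD a1 0) : a1 ∈ subIdx.getD a2 [] := by
  have hsz : a2 < subIdx.size := by simp [subIdx, ups2_size, h2]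
  rw [getD_eq_getElem _ _ hsz]
  simp only [subIdx, Array.getElem_map, List.mem_filter, List.mem_range, ups2_size, beq_iff_eq]
  refine ⟨h1, ?_⟩
  have hsz2 : a2 < ups2.size := by rw [ups2_size]; exact h2
  rw [← getD_eq_getElem ups2 0 hsz2]
  exact hsub

/-- COMPLETENESS: every up-set bitmask of `[3]³` is an entry of `ups3`. [this work] -/
theorem exists_ups3_eq {T : ℕ} (hT : IsUp3 T) : ∃ b, b < 980 ∧ ups3.getD b 0 = T := by
  obtain ⟨a0, h0, e0⟩ := exists_ups2_eq (slice_lt T 0) (isUp2_slice hT (by norm_num : 0 < 3))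
  obtain ⟨a1, h1, e1⟩ := exists_ups2_eq (slice_lt T 1) (isUp2_slice hT (by norm_num : 1 < 3))
  obtain ⟨a2, h2, e2⟩ := exists_ups2_eq (slice_lt T 2) (isUp2_slice hT (by norm_num : 2 < 3))
  have h10 : a0 ∈ subIdx.getD a1 [] :=
    mem_subIdx_getD h1 h0 (by rw [e0, e1]; exact slice_land_slice_succ hT (by norm_num : 0 < 2))
  have h21 : a1 ∈ subIdx.getD a2 [] :=
    mem_subIdx_getD h2 h1 (by rw [e1, e2]; exact slice_land_slice_succ hT (by norm_num : 1 < 2))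
  have hmem : T ∈ ups3.toList := by
    simp only [ups3, List.toList_toArray, List.mem_flatMap, List.mem_map, List.mem_range, ups2_size]
    refine ⟨a2, h2, a1, h21, a0, h10, ?_⟩
    rw [e0, e1, e2]
    exact eq_of_slices hT.1
  obtain ⟨i, hi, hget⟩ := List.getElem_of_mem hmem
  rw [Array.length_toList] at hi
  refine ⟨i, by rw [ups3_size] at hi; exact hi, ?_⟩
  rw [getD_eq_getElem _ _ hi, ← hget, Array.getElem_toList]

/-! ## The DP minimum is a lower bound -/

/-- `Σ_{v < 9, v ∈ S} f[v + 9k]`: the contribution of slice `k` with bitmask `S`. [this work] -/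
def sliceSum (f : Array ℤ) (S k : ℕ) : ℤ := (((List.range 9).filter fun v => S.testBit v).map fun v => f.getD (v + 9 * k) 0).sum

/-- `sliceCost` at an index of `ups2` is the `sliceSum` of that up-set. [this work] -/
theorem sliceCost_eq_sliceSum (f : Array ℤ) (k : ℕ) {a : ℕ} (ha : a < 20) :
    sliceCost f k a = sliceSum f (ups2.getD a 0) k := by
  have hsz : a < bits2.size := by simp [bits2, ups2_size, ha]
  unfold sliceCost sliceSum
  rw [getD_eq_getElem _ _ hsz]
  simp only [bits2, Array.getElem_map]
  rw [getD_eq_getElem _ _ (by rw [ups2_size]; exact ha)]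

/-- **The DP bound**: for every up-set bitmask `A` of `[3]³`, `minUp3 f ≤ Σ_{u ∈ A} f[u]` (slice form). [this work] -/
theorem minUp3_le {A : ℕ} (hA : IsUp3 A) (f : Array ℤ) :
    minUp3 f ≤ sliceSum f (slice A 0) 0 + sliceSum f (slice A 1) 1 + sliceSum f (slice A 2) 2 := by
  obtain ⟨a0, h0, e0⟩ := exists_ups2_eq (slice_lt A 0) (isUp2_slice hA (by norm_num : 0 < 3))
  obtain ⟨a1, h1, e1⟩ := exists_ups2_eq (slice_lt A 1) (isUp2_slice hA (by norm_num : 1 < 3))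
  obtain ⟨a2, h2, e2⟩ := exists_ups2_eq (slice_lt A 2) (isUp2_slice hA (by norm_num : 2 < 3))
  have h10 : a0 ∈ subIdx.getD a1 [] :=
    mem_subIdx_getD h1 h0 (by rw [e0, e1]; exact slice_land_slice_succ hA (by norm_num : 0 < 2))
  have h21 : a1 ∈ subIdx.getD a2 [] :=
    mem_subIdx_getD h2 h1 (by rw [e1, e2]; exact slice_land_slice_succ hA (by norm_num : 1 < 2))
  unfold minUp3
  simp only []
  -- step 2: the outer minimum is below its `a2` entry
  refine le_trans (minOver_le _ (List.mem_range.2 h2)) ?_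
  rw [getD_map_range _ _ h2, getD_map_range _ _ h2]
  -- step 1
  have hg1 : minOver (fun a1' => (((List.range 20).map fun a => sliceCost f 1 a).toArray).getD a1' 0 +
      (((List.range 20).map fun a1'' => minOver (fun a0' => (((List.range 20).map fun a => sliceCost f 0 a).toArray).getD a0' 0)
        (subIdx.getD a1'' [])).toArray).getD a1' 0) (subIdx.getD a2 []) ≤
      sliceCost f 1 a1 + sliceCost f 0 a0 := by
    refine le_trans (minOver_le _ h21) ?_
    rw [getD_map_range _ _ h1, getD_map_range _ _ h1]
    have hg0 := minOver_le (fun a0' => (((List.range 20).map fun a => sliceCost f 0 a).toArray).getD a0' 0) h10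
    rw [getD_map_range _ _ h0] at hg0
    omega
  rw [sliceCost_eq_sliceSum f 1 h1, sliceCost_eq_sliceSum f 0 h0, e0, e1] at hg1
  rw [sliceCost_eq_sliceSum f 2 h2, e2]
  omega

/-- **The combinatorial kernel in `φ`-form**: if every DP minimum of a `φ`-table over the `980²` ordered pairs of up-sets is `≥ 0`
(this is `checkBlock_A ∧ … ∧ checkBlock_D`, unpacked by `checkBlock_sound`), then `Σ_{u ∈ A} φ_{B,C}(u) ≥ 0` for all up-set bitmasks
`A, B, C` of `[3]³`. [this work] -/
theorem sum_phi_nonneg_of_check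
    (hchk : ∀ b c, b < 980 → c < 980 → 0 ≤ minUp3 (phiTab (ups3.getD b 0) (ups3.getD c 0)))
    {A B C : ℕ} (hA : IsUp3 A) (hB : IsUp3 B) (hC : IsUp3 C) :
    0 ≤ sliceSum (phiTab B C) (slice A 0) 0 + sliceSum (phiTab B C) (slice A 1) 1 + sliceSum (phiTab B C) (slice A 2) 2 := by
  obtain ⟨b, hb, rfl⟩ := exists_ups3_eq hB
  obtain ⟨c, hc, rfl⟩ := exists_ups3_eq hC
  exact le_trans (hchk b c hb hc) (minUp3_le hA _)

/-- Entries of the `φ`-table. [this work] -/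
theorem phiTab_getD {B C u : ℕ} (hu : u < 27) : (phiTab B C).getD u 0 = phi B C u := by
  unfold phiTab
  exact getD_map_range _ _ hu

/-! ## From the slice form to a sum over the codes `u < 27` -/

/-- `sliceSum` as a `Finset` sum. [this work] -/
theorem sliceSum_eq_finset (f : Array ℤ) (S k : ℕ) :
    sliceSum f S k = ∑ v ∈ (Finset.range 9).filter (fun v => S.testBit v = true), f.getD (v + 9 * k) 0 := by
  unfold sliceSum
  rw [← List.toFinset_range, ← List.toFinset_filter, List.sum_toFinset _ (List.Nodup.filter _ (List.nodup_range))]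

/-- The three slice sums of `A` add up to the sum of `f` over the members `u < 27` of `A`. [this work] -/
theorem sliceSum_sum_eq {A : ℕ} (f : Array ℤ) :
    sliceSum f (slice A 0) 0 + sliceSum f (slice A 1) 1 + sliceSum f (slice A 2) 2 =
      ∑ u ∈ (Finset.range 27).filter (fun u => A.testBit u = true), f.getD u 0 := by
  simp only [sliceSum_eq_finset, Finset.sum_filter]
  have h9 : ∀ k v, v < 9 → ((slice A k).testBit v = true ↔ A.testBit (9 * k + v) = true) := by
    intro k v hv; rw [testBit_slice_of_lt hv]
  have hk : ∀ k, ∑ v ∈ Finset.range 9, (if (slice A k).testBit v = true then f.getD (v + 9 * k) 0 else 0) =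
      ∑ v ∈ Finset.range 9, (if A.testBit (9 * k + v) = true then f.getD (9 * k + v) 0 else 0) := by
    intro k
    refine Finset.sum_congr rfl fun v hv => ?_
    rw [Finset.mem_range] at hv
    simp only [h9 k v hv, show v + 9 * k = 9 * k + v by ring]
  rw [hk 0, hk 1, hk 2]
  rw [show Finset.range 27 = Finset.Ico 0 27 from Finset.range_eq_Ico 27,
    ← Finset.sum_Ico_consecutive _ (show 0 ≤ 9 by norm_num) (show 9 ≤ 27 by norm_num),
    ← Finset.sum_Ico_consecutive _ (show 9 ≤ 18 by norm_num) (show 18 ≤ 27 by norm_num),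
    Finset.sum_Ico_eq_sum_range, Finset.sum_Ico_eq_sum_range, Finset.sum_Ico_eq_sum_range]
  norm_num [add_assoc]

/-- **The combinatorial kernel, code form**: under the check hypothesis, `Σ_{u < 27, u ∈ A} φ_{B,C}(u) ≥ 0` for all up-set bitmasks
`A, B, C` of `[3]³`. [this work] -/
theorem sum_phi_nonneg_of_check' (hchk : ∀ b c, b < 980 → c < 980 → 0 ≤ minUp3 (phiTab (ups3.getD b 0) (ups3.getD c 0)))
    {A B C : ℕ} (hA : IsUp3 A) (hB : IsUp3 B) (hC : IsUp3 C) :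
    0 ≤ ∑ u ∈ (Finset.range 27).filter (fun u => A.testBit u = true), phi B C u := by
  have h := sum_phi_nonneg_of_check hchk hA hB hC
  rw [sliceSum_sum_eq] at h
  refine le_trans h (le_of_eq (Finset.sum_congr rfl fun u hu => ?_))
  rw [Finset.mem_filter, Finset.mem_range] at hu
  exact phiTab_getD hu.1

end Summit.CriticalPhenomena.PercolationContinuityZ3.Theorems.SahiThreeChains
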